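import Literature.MathematicalPhysics.QuantumFieldTheory.Balaban1983to89.B6Eq238LocalInverseV1
import Literature.MathematicalPhysics.QuantumFieldTheory.Balaban1983to89.B6GOmegaCritical

/-!
# `Balaban1983to89.B6GOmegaCriticalV1` — T. Bałaban, *Propagators and renormalization transformations for lattice gauge
# theories. II*, Commun. Math. Phys. **96** (1984) 223–250 [Balaban1984PropagatorsII], Sect. A p. 228, the `G(Ω)` variant
# (*"Dirichlet boundary conditions on Ω^c"*) ON THE V1 MULTI-LEVEL TORUS CALCULUS: for the CONCRETE `Δ_a` (2.19), `∂`, `∂*`,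
# `Q`, `Q*`, `R` of `…B6SectAOperatorsV1` / `…B6SectAVectorModelV1` (gen 5) and `G(Ω) = (Δ_a↾_Ω)⁻¹ = (ΩΔ_aΩ)⁻¹` of
# `…B6Eq238LocalInverseV1` (gen 6), every nested family of domains, `c ≠ 0`, `a > 0`, and EVERY set `Ω` of fine bonds
# containing the bonds within one lattice step of `Ω₁` — ***"the equalities (2.31), (2.34) hold for the operator G(Ω) also"***
# PROVED with no hypothesis left, together with the first p. 228 display and `λ = 0` at every critical point of the
# `Ω`-Lagrange function

statement-level skeleton of published theorems with citation tags; proofs where landed; nothing here is a claim about the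
Yang–Mills mass gap

PDF held: `paper:balaban1984-cmp96-propagators-rt-ii` (journal page = PDF page + 222); p. 228 [PDF 6] read AS AN IMAGE on the
×2 render `run/shared/lean/pub/pub-balaban/b2b-balaban-ref1/pages/1984-cmp96-propagators-rt-II/…-p006-x2.png`.

CITATION HEADER (lean-in-tree rule).  Cell `lit-balaban` (HOME `run/shared/lean/pub/lit-balaban/`), PHASE-2 proof seat **p21**
(gen 6, file 7), B6 fold owner r03, referee ref-4.  WHAT IS REPRODUCED: SKELETON row **B6.Txt@228** (the unnumbered p. 228
displays; owner head `proved p246565` = r03's `…B6GOmegaCritical` over ABSTRACT carriers, whose support hypotheses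
`hΩd : Ω∂n = ∂n (n ∈ N(Q′))`, `hΩdR : Ω∂Rμ = ∂Rμ`, inverse hypotheses `hG`/`hGΩ`/`hGs` and structure hypotheses are
DISCHARGED here) — KIND model instance: `G(Ω)` is gen 6's CONSTRUCTED `…B6Eq238LocalInverseV1.GOmegaE` (p255455), the
structure is gen 5's (`deltaAE_def`, `dcE_comp_dE`, `QE_dE_eq_zero`, `RE_range`, `RE_fix`, the adjoint pairs), and the two
support hypotheses become ONE COMBINATORIAL MARGIN CONDITION on the bond set `Ω` (`IsMargin`: `Ω` contains every fine bond
with an end-point within one lattice step of the sites of `Ω₁`), which is what the print's *"neighbourhood Ω of the domain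
Ω₁ … a sum of big blocks of the lattice T₁"* guarantees.  Theorems + two predicate definitions with bodies (`NearOm1`,
`IsMargin`); r03's file is used BY NAME, nothing restated.

PRINT (p. 228, verbatim).  *"The variational problem (2.5), (2.6), (2.12) can be solved also in a different way. We use the
fact that the configuration A is fixed outside Ω₁ by the conditions (2.6), thus we should obtain a solution of the problem
using operators chosen arbitrarily there, especially operators with arbitrary boundary conditions outside Ω₁. Let us take a
neighbourhood Ω of the domain Ω₁. We assume that it is a sum of big blocks of the lattice T₁. … We will consider operators
with Dirichlet boundary conditions on Ω^c. For the quadratic form (2.5) we have by (2.6),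
½⟨A, ∂*∂A⟩ = ½⟨A, Ω∂*∂ΩA⟩ + ⟨A, Ω∂*∂Ω^cB⟩ + ½⟨B, Ω^c∂*∂Ω^cB⟩, hence the Lagrange function can be taken as equal to
h(A, λ, ω) = ½⟨A, ΩΔ_aΩA⟩ + ⟨A, Ω∂*∂Ω^cB⟩ + ½⟨B, Ω^c∂*∂Ω^cB⟩ − ½⟨ΩB, aΩB⟩ − ⟨λ, R∂*A⟩ − ⟨ω, QA − B⟩, Rλ = λ, ω = 0 on Ω^c.
… Solving critical point equations for h(A, λ, ω) and denoting G(Ω) = (Δ_a↾_Ω)⁻¹ = (ΩΔ_aΩ)⁻¹, we get A = … We have to notice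
only that the equalities (2.31), (2.34) hold for the operator G(Ω) also."*

TYPED READING (every choice displayed; none is an objection to print).  Carriers and operators = gen 5's on
`LatticeFieldCalculus` (`D : …B6SectADomainsV1.Domains`): bond fields `BondSpace P`, `∂ = dcE c` (vector → plaquette) with
adjoint `dcsE c`, `∂ = dE c` (scalar → vector) with adjoint `∂* = dsE c`, `Q = QE D` (ALL the constraints (2.20), incl.
`Q₀ = id` on `Λ₀`), `Q* = QsE D`, `a = aE D w`, `R = RE D c` (orthogonal projection onto `ΔN(Q′)`), `N(Q′) = ker (QpE D)`,
`Δ_a = deltaAE D c w` (2.19).  `Ω` = ANY decidable set of fine bonds, acting as the cut-off `cutB Ω` (gen 6); `G(Ω) =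
GOmegaE D hc hw Ω`.  `Ω₁` as a set of fine SITES is `{x | D.Deep 0 x}` (`Λ₀ = Ω₁ᶜ`: `D.lamSite_zero_iff`).  THE MARGIN: the
print takes `Ω ⊇ Ω₁` a union of big `T₁`-blocks forming a neighbourhood of `Ω₁`; what the two support facts need — and all
that is assumed here — is `IsMargin D Ω`: every fine bond with an end-point `y` such that `y` or a nearest neighbour `y ± e_μ`
lies in `Ω₁` belongs to `Ω` (then `∂n` and `∂Δn`, `n ∈ N(Q′)`, live on the bonds of `Ω`, because `n` vanishes off `Ω₁`).
The printed representation of the critical configuration with `(QG(Ω)Q*)⁻¹` needs the multipliers restricted to the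
constraints inside `Ω` (*"ω = 0 on Ω^c"*); that operator-level instance is NOT in this file (r03's `critical_repr` /
`existsUnique_ELO` remain the theorems of record for it); here: the identities, the form split, and `λ = 0`.

WHAT IS PROVED (0 sorry, 0 new named facts; axioms standard).
§1 `NearOm1`, `IsMargin` (defs with bodies); `isMargin_top` (Ω = all bonds is admissible — *"we admit the case when some
domains Ω_j are equal to T_η"*).
§2 SUPPORTS: `ofLp_apply_eq_zero_of_not_deep` (`n ∈ N(Q′)` vanishes off `Ω₁`), `dE_apply_eq_zero`, `laplace_ofLp_apply_eq_zero`,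
`dE_lapE_apply_eq_zero`, **`cutB_dE_of_mem_ker`** (r03's `hΩd` on the model), **`cutB_dE_RE`** (r03's `hΩdR`),
`GOmegaE_cutB_deltaAE_cutB` (r03's `hG` shape).
§3 ***"(2.31), (2.34) hold for the operator G(Ω) also"*** with NO hypothesis left but the margin: `GOmega_d_RE` (`G(Ω)∂Rμ = ∂n`),
**`eq231_GOmega_V1`** (`R∂*G(Ω)∂R = R`), **`eq234_right_GOmega_V1`** (`QG(Ω)∂R = 0`), **`eq234_left_GOmega_V1`** (`R∂*G(Ω)Q* = 0`),
`RE_dsE_GOmega_exterior` (`R∂*G(Ω)Ω∂*∂X = 0` for every exterior field `X`).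
§4 `form_split_V1` (the first p. 228 display on the model), **`lam_eq_zero_V1`** (at every solution of r03's critical-point
system `ELO` on the model — ANY exterior field `X`, ANY constraint datum — the gauge multiplier vanishes), `GOmegaE_top`
(`G(T) = G`: with `Ω` = all bonds, `G(Ω)` is gen 5's `GE = Δ_a⁻¹`).
-/

noncomputable section

open scoped InnerProductSpace

namespace Literature.MathematicalPhysics.QuantumFieldTheory.Balaban1983to89.B6GOmegaCriticalV1

open LatticeFieldCalculus B6SectADomainsV1 B6SectAZeroModesV1 B6SectAOntoV1 B6SectAOperatorsV1 B6SectAVectorModelV1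
  B6SectACriticalPointV1 B6SectAScalarModelV1 B6Eq238LocalInverseV1
open BalabanImbrieJaffe1984to88.BIJ85AxialPropagator411 (BondSpace PlaqSpace)

variable {P : Params} (D : Domains P)

/-! ## §1. The margin condition on `Ω` -/

/-- the one-step enlargement of `Ω₁` (as fine sites, `Ω₁ = {x | D.Deep 0 x}`): `y` or one of its nearest neighbours `y ± e_μ`
lies in `Ω₁`. [cite: Balaban1984PropagatorsII, p.228 (neighbourhood Ω of Ω₁)] -/
def NearOm1 (y : Site P 0) : Prop :=
  D.Deep 0 y ∨ ∃ μ : Fin P.d, D.Deep 0 (y.shift μ) ∨ D.Deep 0 (y.unshift μ)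

/-- **the margin condition** on a set `Ω` of fine bonds (*"Let us take a neighbourhood Ω of the domain Ω₁ … a sum of big
blocks of the lattice T₁"*), in the form the support arguments use: every fine bond with an end-point in the one-step
enlargement of `Ω₁` belongs to `Ω`. [cite: Balaban1984PropagatorsII, p.228 (neighbourhood Ω of Ω₁)] -/
def IsMargin (Ω : PBond P 0 → Prop) : Prop :=
  ∀ b : PBond P 0, (NearOm1 D b.src ∨ NearOm1 D b.tgt) → Ω b

/-- `Ω = T` (all bonds) satisfies the margin condition (*"we admit the case when some domains Ω_j are equal to T_η"*, p. 224).
[cite: Balaban1984PropagatorsII, (2.2) p.224 + p.228] -/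
theorem isMargin_top : IsMargin D (fun _ : PBond P 0 => True) := fun _ _ => trivial

/-! ## §2. Supports: `∂n` and `∂Δn`, `n ∈ N(Q′)`, live on the bonds of `Ω` -/

/-- `n ∈ N(Q′)` vanishes off `Ω₁` (*"λ = 0 on Λ₀"*, (2.7), `Λ₀ = Ω₁ᶜ`). [cite: Balaban1984PropagatorsII, (2.7) p.224] -/
theorem ofLp_apply_eq_zero_of_not_deep {n : ScalarSpace P} (hn : n ∈ LinearMap.ker (QpE D)) {y : Site P 0}
    (hy : ¬ D.Deep 0 y) : WithLp.ofLp n y = 0 :=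
  (mem_ker_QpE_iff D n).mp hn 0 y ((D.lamSite_zero_iff y).mpr hy)

/-- `(∂n)(b) = 0` on a bond with both end-points off `Ω₁`, `n ∈ N(Q′)`. [cite: Balaban1984PropagatorsII, (2.7) p.224 + p.228] -/
theorem dE_apply_eq_zero (c : ℝ) {n : ScalarSpace P} (hn : n ∈ LinearMap.ker (QpE D)) {b : PBond P 0}
    (hs : ¬ D.Deep 0 b.src) (ht : ¬ D.Deep 0 b.tgt) : dE c n b = 0 := by
  have h : dE c n b = grad c (WithLp.ofLp n) b := by rw [← ofLp_dE]
  rw [h, grad, ofLp_apply_eq_zero_of_not_deep D hn hs, ofLp_apply_eq_zero_of_not_deep D hn ht, sub_zero, smul_zero]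

/-- `(Δn)(y) = 0` off the one-step enlargement of `Ω₁`, `n ∈ N(Q′)` (`Δ` is a nearest-neighbour operator).
[cite: Balaban1984PropagatorsII, (2.10) p.225 + p.228] -/
theorem laplace_ofLp_apply_eq_zero (c : ℝ) {n : ScalarSpace P} (hn : n ∈ LinearMap.ker (QpE D)) {y : Site P 0}
    (hy : ¬ NearOm1 D y) : laplace c (WithLp.ofLp n) y = 0 := by
  simp only [NearOm1, not_or, not_exists] at hy
  obtain ⟨hy0, hμ⟩ := hy
  unfold laplace
  refine Finset.sum_eq_zero fun μ _ => ?_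
  rw [ofLp_apply_eq_zero_of_not_deep D hn hy0, ofLp_apply_eq_zero_of_not_deep D hn (hμ μ).1,
    ofLp_apply_eq_zero_of_not_deep D hn (hμ μ).2]
  simp

/-- `(∂Δn)(b) = 0` on a bond with both end-points off the one-step enlargement of `Ω₁`, `n ∈ N(Q′)`.
[cite: Balaban1984PropagatorsII, (2.10) p.225 + p.228] -/
theorem dE_lapE_apply_eq_zero (c : ℝ) {n : ScalarSpace P} (hn : n ∈ LinearMap.ker (QpE D)) {b : PBond P 0}
    (hs : ¬ NearOm1 D b.src) (ht : ¬ NearOm1 D b.tgt) : dE c (lapE c n) b = 0 := by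
  have h : dE c (lapE c n) b = grad c (laplace c (WithLp.ofLp n)) b := by rw [← ofLp_lapE, ← ofLp_dE]
  rw [h, grad, laplace_ofLp_apply_eq_zero D c hn hs, laplace_ofLp_apply_eq_zero D c hn ht, sub_zero, smul_zero]

/-- **r03's `hΩd` ON THE MODEL: `Ω∂n = ∂n` for `n ∈ N(Q′)`** whenever `Ω` satisfies the margin condition.
[cite: Balaban1984PropagatorsII, p.228 ((2.31), (2.34) for G(Ω))] -/
theorem cutB_dE_of_mem_ker {Ω : PBond P 0 → Prop} [DecidablePred Ω] (hΩ : IsMargin D Ω) (c : ℝ) {n : ScalarSpace P}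
    (hn : n ∈ LinearMap.ker (QpE D)) : cutB Ω (dE c n) = dE c n := by
  refine PiLp.ext fun b => ?_
  rw [cutB_apply]
  split_ifs with hb
  · rfl
  · have hb' : ¬ (NearOm1 D b.src ∨ NearOm1 D b.tgt) := fun h => hb (hΩ b h)
    rw [not_or] at hb'
    exact (dE_apply_eq_zero D c hn (fun h => hb'.1 (Or.inl h)) (fun h => hb'.2 (Or.inl h))).symm

/-- **r03's `hΩdR` ON THE MODEL: `Ω∂Rμ = ∂Rμ` for every `μ`** (`Rμ = Δn`, `n ∈ N(Q′)`: gen 5's `RE_range`) whenever `Ω`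
satisfies the margin condition. [cite: Balaban1984PropagatorsII, p.228 ((2.31), (2.34) for G(Ω))] -/
theorem cutB_dE_RE {Ω : PBond P 0 → Prop} [DecidablePred Ω] (hΩ : IsMargin D Ω) (c : ℝ) (v : ScalarSpace P) :
    cutB Ω (dE c (RE D c v)) = dE c (RE D c v) := by
  obtain ⟨n, hn, hv⟩ := RE_range D c v
  rw [hv]
  change cutB Ω (dE c (lapE c n)) = dE c (lapE c n)
  refine PiLp.ext fun b => ?_
  rw [cutB_apply]
  split_ifs with hb
  · rfl
  · have hb' : ¬ (NearOm1 D b.src ∨ NearOm1 D b.tgt) := fun h => hb (hΩ b h)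
    rw [not_or] at hb'
    exact (dE_lapE_apply_eq_zero D c hn hb'.1 hb'.2).symm

/-- r03's `hG` in its printed shape `G(Ω)(Ω(Δ_a(Ωy))) = Ωy` for gen 6's constructed `G(Ω)` (`G(Ω)Ω = G(Ω)`, `G(Ω)Δ_aΩ = Ω`).
[cite: Balaban1984PropagatorsII, p.228 (G(Ω))] -/
theorem GOmegaE_cutB_deltaAE_cutB {c : ℝ} (hc : c ≠ 0) {w : BondIdx D → ℝ} (hw : ∀ i, 0 < w i) (Ω : PBond P 0 → Prop)
    [DecidablePred Ω] (y : BondSpace P) :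
    GOmegaE D hc hw Ω (cutB Ω (deltaAE D c w (cutB Ω y))) = cutB Ω y := by
  rw [GOmegaE_cutB]; exact GOmegaE_deltaAE_cutB D hc hw Ω y

/-! ## §3. *"the equalities (2.31), (2.34) hold for the operator G(Ω) also"* — no hypothesis left but the margin -/

/-- **the mechanism on the model**: `G(Ω)∂Rμ = ∂n` whenever `Rμ = Δn = ∂*∂n`, `n ∈ N(Q′)` (r03's `G_d_R`, every hypothesis
discharged). [cite: Balaban1984PropagatorsII, p.228 ((2.31), (2.34) for G(Ω))] -/
theorem GOmega_d_RE {Ω : PBond P 0 → Prop} [DecidablePred Ω] (hΩ : IsMargin D Ω) {c : ℝ} (hc : c ≠ 0)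
    {w : BondIdx D → ℝ} (hw : ∀ i, 0 < w i) {μ n : ScalarSpace P} (hn : n ∈ LinearMap.ker (QpE D))
    (hμ : RE D c μ = dsE c (dE c n)) :
    GOmegaE D hc hw Ω (dE c (RE D c μ)) = dE c n :=
  B6GOmegaCritical.G_d_R (deltaAE D c w) (dcE c) (dcsE c) (aE D w) (dE c) (dsE c) (RE D c) (QpE D) (QE D) (QsE D)
    (cutB Ω) (GOmegaE D hc hw Ω) (deltaAE_def D c w) (dcE_comp_dE c) (QE_dE_eq_zero D c) (RE_fix D c)
    (fun _ hn' => cutB_dE_of_mem_ker D hΩ c hn') (cutB_dE_RE D hΩ c) (GOmegaE_cutB_deltaAE_cutB D hc hw Ω) hn hμ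

/-- **(2.31) for `G(Ω)` ON THE MODEL: `R∂*G(Ω)∂R = R`** — every nested family of domains, `c ≠ 0`, `a > 0`, every bond set
`Ω` with the margin. [cite: Balaban1984PropagatorsII, p.228 ((2.31) for G(Ω))] -/
theorem eq231_GOmega_V1 {Ω : PBond P 0 → Prop} [DecidablePred Ω] (hΩ : IsMargin D Ω) {c : ℝ} (hc : c ≠ 0)
    {w : BondIdx D → ℝ} (hw : ∀ i, 0 < w i) :
    RE D c ∘ₗ dsE c ∘ₗ GOmegaE D hc hw Ω ∘ₗ dE c ∘ₗ RE D c = RE D c :=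
  B6GOmegaCritical.eq231_Omega (deltaAE D c w) (dcE c) (dcsE c) (aE D w) (dE c) (dsE c) (RE D c) (QpE D) (QE D)
    (QsE D) (cutB Ω) (GOmegaE D hc hw Ω) (deltaAE_def D c w) (dcE_comp_dE c) (QE_dE_eq_zero D c) (RE_range D c)
    (RE_fix D c) (fun _ hn => cutB_dE_of_mem_ker D hΩ c hn) (cutB_dE_RE D hΩ c) (GOmegaE_cutB_deltaAE_cutB D hc hw Ω)

/-- **(2.34)₂ for `G(Ω)` ON THE MODEL: `QG(Ω)∂R = 0`.** [cite: Balaban1984PropagatorsII, p.228 ((2.34) for G(Ω))] -/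
theorem eq234_right_GOmega_V1 {Ω : PBond P 0 → Prop} [DecidablePred Ω] (hΩ : IsMargin D Ω) {c : ℝ} (hc : c ≠ 0)
    {w : BondIdx D → ℝ} (hw : ∀ i, 0 < w i) :
    QE D ∘ₗ GOmegaE D hc hw Ω ∘ₗ dE c ∘ₗ RE D c = 0 :=
  B6GOmegaCritical.eq234_Omega_right (deltaAE D c w) (dcE c) (dcsE c) (aE D w) (dE c) (dsE c) (RE D c) (QpE D)
    (QE D) (QsE D) (cutB Ω) (GOmegaE D hc hw Ω) (deltaAE_def D c w) (dcE_comp_dE c) (QE_dE_eq_zero D c)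
    (RE_range D c) (RE_fix D c) (fun _ hn => cutB_dE_of_mem_ker D hΩ c hn) (cutB_dE_RE D hΩ c)
    (GOmegaE_cutB_deltaAE_cutB D hc hw Ω)

/-- **(2.34)₁ for `G(Ω)` ON THE MODEL: `R∂*G(Ω)Q* = 0`** (`G(Ω)` symmetric: gen 6's `inner_GOmegaE_left`).
[cite: Balaban1984PropagatorsII, p.228 ((2.34) for G(Ω))] -/
theorem eq234_left_GOmega_V1 {Ω : PBond P 0 → Prop} [DecidablePred Ω] (hΩ : IsMargin D Ω) {c : ℝ} (hc : c ≠ 0)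
    {w : BondIdx D → ℝ} (hw : ∀ i, 0 < w i) :
    RE D c ∘ₗ dsE c ∘ₗ GOmegaE D hc hw Ω ∘ₗ QsE D = 0 :=
  B6GOmegaCritical.eq234_Omega_left (deltaAE D c w) (dcE c) (dcsE c) (aE D w) (dE c) (dsE c) (RE D c) (QpE D)
    (QE D) (QsE D) (cutB Ω) (GOmegaE D hc hw Ω) (deltaAE_def D c w) (dcE_comp_dE c) (QE_dE_eq_zero D c)
    (RE_range D c) (RE_fix D c) (fun _ hn => cutB_dE_of_mem_ker D hΩ c hn) (cutB_dE_RE D hΩ c)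
    (GOmegaE_cutB_deltaAE_cutB D hc hw Ω) (inner_dE_left c) (inner_RE_left D c) (inner_QsE_left D)
    (inner_GOmegaE_left D hc hw Ω)

/-- **the same mechanism on the exterior source, ON THE MODEL: `R∂*G(Ω)Ω∂*∂X = 0`** for every field `X` — the boundary term
`⟨A, Ω∂*∂Ω^cB⟩` of the `Ω`-Lagrange function exerts no force on the gauge-fixing multiplier.
[cite: Balaban1984PropagatorsII, p.228 ((2.31), (2.34) for G(Ω))] -/
theorem RE_dsE_GOmega_exterior {Ω : PBond P 0 → Prop} [DecidablePred Ω] (hΩ : IsMargin D Ω) {c : ℝ} (hc : c ≠ 0)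
    {w : BondIdx D → ℝ} (hw : ∀ i, 0 < w i) (X : BondSpace P) :
    RE D c (dsE c (GOmegaE D hc hw Ω (cutB Ω (dcsE c (dcE c X))))) = 0 :=
  B6GOmegaCritical.R_dstar_G_C (deltaAE D c w) (dcE c) (dcsE c) (aE D w) (dE c) (dsE c) (RE D c) (QpE D) (QE D)
    (QsE D) (cutB Ω) (GOmegaE D hc hw Ω) (deltaAE_def D c w) (dcE_comp_dE c) (QE_dE_eq_zero D c) (RE_range D c)
    (RE_fix D c) (fun _ hn => cutB_dE_of_mem_ker D hΩ c hn) (cutB_dE_RE D hΩ c) (GOmegaE_cutB_deltaAE_cutB D hc hw Ω)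
    (inner_dcsE_left c) (inner_dE_left c) (inner_RE_left D c) (inner_cutB_left Ω) (inner_GOmegaE_left D hc hw Ω) X

/-! ## §4. The first p. 228 display, `λ = 0`, and the case `Ω = T` -/

/-- **p. 228, first display, ON THE MODEL**: for a configuration `A = x + X` split into its part `x = ΩA` on the bonds of `Ω`
and its exterior part `X` (`ΩX = 0`), `½⟨A, ∂*∂A⟩ = ½⟨A, Ω∂*∂ΩA⟩ + ⟨A, Ω∂*∂X⟩ + ½⟨X, ∂*∂X⟩` (`∂*∂ = dcsE∘dcE`).
[cite: Balaban1984PropagatorsII, p.228 (first display)] -/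
theorem form_split_V1 (Ω : PBond P 0 → Prop) [DecidablePred Ω] (c : ℝ) {x X : BondSpace P} (hx : cutB Ω x = x)
    (hX : cutB Ω X = 0) :
    (1 / 2) * ⟪x + X, dcsE c (dcE c (x + X))⟫_ℝ =
      (1 / 2) * ⟪x + X, cutB Ω (dcsE c (dcE c (cutB Ω (x + X))))⟫_ℝ + ⟪x + X, cutB Ω (dcsE c (dcE c X))⟫_ℝ
        + (1 / 2) * ⟪X, dcsE c (dcE c X)⟫_ℝ :=
  B6GOmegaCritical.form_split (dcE c) (dcsE c) (cutB Ω) (inner_dcsE_left c) (inner_cutB_left Ω) hx hX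

/-- **`λ = 0` at every critical point of the `Ω`-Lagrange function, ON THE MODEL**: for every bond set `Ω` with the margin,
every exterior field `X`, every constraint datum `B` and every solution `(x, λ, ω)`, `Rλ = λ`, of r03's critical-point system
`ELO` (with the full constraint operator `Q` of (2.20)), the gauge-fixing multiplier vanishes — r03's `lam_eq_zero` with
every structural hypothesis discharged. [cite: Balaban1984PropagatorsII, p.228 (representation of A with G(Ω))] -/
theorem lam_eq_zero_V1 {Ω : PBond P 0 → Prop} [DecidablePred Ω] (hΩ : IsMargin D Ω) (c : ℝ) (w : BondIdx D → ℝ)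
    {X : BondSpace P} {B : BondIdxSpace D} {x : BondSpace P} {lam : ScalarSpace P} {ω : BondIdxSpace D}
    (hRl : RE D c lam = lam)
    (h : B6GOmegaCritical.ELO (deltaAE D c w) (dcE c) (dcsE c) (dE c) (dsE c) (RE D c) (QE D) (QsE D) (cutB Ω) X B
      x lam ω) :
    lam = 0 :=
  B6GOmegaCritical.lam_eq_zero (deltaAE D c w) (dcE c) (dcsE c) (aE D w) (dE c) (dsE c) (RE D c) (QpE D) (QE D)
    (QsE D) (cutB Ω) X B (deltaAE_def D c w) (dcE_comp_dE c) (QE_dE_eq_zero D c) (RE_range D c)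
    (fun _ hn => cutB_dE_of_mem_ker D hΩ c hn) (inner_dcsE_left c) (inner_dE_left c) (inner_QsE_left D)
    (inner_cutB_left Ω) hRl h

/-- the cut-off at `Ω = T` (all bonds) is the identity. [cite: Balaban1984PropagatorsII, (2.2) p.224 + p.228 (Ω)] -/
theorem cutB_top (x : BondSpace P) : cutB (fun _ : PBond P 0 => True) x = x :=
  PiLp.ext fun b => by rw [cutB_apply]; simp

/-- **`G(T) = G`**: with `Ω` = all bonds (admitted by p. 224), gen 6's `G(Ω)` IS gen 5's `G = Δ_a⁻¹` — so §3 contains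
(2.31)/(2.34) themselves (gen 5's `eq231_V1`/`eq234_*_V1`) as the case `Ω = T`. [cite: Balaban1984PropagatorsII, (2.22) p.226 + p.228 (G(Ω))] -/
theorem GOmegaE_top {c : ℝ} (hc : c ≠ 0) {w : BondIdx D → ℝ} (hw : ∀ i, 0 < w i) :
    GOmegaE D hc hw (fun _ : PBond P 0 => True) = GE D hc hw := by
  refine LinearMap.ext fun x => deltaAE_injective D hc hw ?_
  have h1 := cutB_deltaAE_GOmegaE D hc hw (fun _ : PBond P 0 => True) x
  rw [cutB_top, cutB_top] at h1
  rw [h1, deltaAE_GE]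

end Literature.MathematicalPhysics.QuantumFieldTheory.Balaban1983to89.B6GOmegaCriticalV1

end
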